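import Literature.AlgebraicGeometry.Resolution.QuadraticTransformPrincipal
import Literature.AlgebraicGeometry.Resolution.GermsOfClosedSubsets
import Literature.AlgebraicGeometry.Resolution.MarkedIdealsEtale
import Literature.AlgebraicGeometry.Resolution.ProperBirationalGlobalSections
import HarnessLib

/-!
# The structure map `T → 𝒪_{X,x}` of a birational scheme over a local ring, and the key lemma of
# quadratic transforms in ring-homomorphism form

Topic: `Literature/AlgebraicGeometry/Resolution`. Support for rows F79-F1-ii / F1-iii of the sub-cell
«(1.2) 2-reg» of the D-0154 (2) RES inputs cell (`ResolutionClosedPointCartier.lean`: the closed point of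
a two-dimensional regular local ring pulls back to an effective Cartier divisor on a resolution having
an exceptional curve). For `π : X → Spec T` and `x ∈ X`, the structure map `T → Γ(X, 𝒪_X) → 𝒪_{X,x}`
is written `((X.presheaf.germ ⊤ x trivial).hom.comp (algebraMapΓ π))` throughout (no definition is
introduced).

* `exists_map_maximalIdeal_eq_span_singleton_of_not_surjective` — **the key lemma of quadratic
  transforms in ring-homomorphism form** (from the `Subring K` form
  `exists_map_maximalIdeal_eq_span_singleton_of_ne`, Huneke–Swanson Thm. 14.5.2 "the crucial point"):
  for an injective, non-surjective local homomorphism `f : R → S` of two-dimensional regular local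
  rings with a common fraction field, `𝔪_R S` is principal, generated by a non-zero element.
* `germ_algebraMapΓ_eq_stalkMap_germ`, `germ_top_ΓSpecIso_inv_eq_algebraMap` — `T → 𝒪_{X,x}` is the
  stalk map `π^*_x` after the localisation `T → T_{π x}`;
  `isLocalHom_germ_algebraMapΓ` — it is a local homomorphism at points over the closed point;
  `stalkIdeal_comap_eq_map_maximalIdeal` — for the ideal sheaf `I` of the closed point
  (`I(⊤) = 𝔪_T`), `(I·𝒪_X)_x = 𝔪_T 𝒪_{X,x}`; `base_eq_closedPoint_of_mem_support_comap` — the support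
  of `I·𝒪_X` lies over the closed point.
* For `π` birational with `X` integral and `T` a domain: `algebraMap_germ_algebraMapΓ` (compatibility
  with `T → K(X)`, `baseToFunctionField`), `germ_algebraMapΓ_injective`, `exists_eq_div_germ_algebraMapΓ`
  (`K(X) = Frac T` through `𝒪_{X,x}`), and `germ_algebraMapΓ_not_surjective` — `T → 𝒪_{X,x}` is not
  onto when a proper generisation of `x` also lies over the closed point (its prime in `𝒪_{X,x}` is
  non-maximal and contains `𝔪_T`).

Everything is proved; no definitions, no named facts.

## References

* C. Huneke, I. Swanson, *Integral Closure of Ideals, Rings, and Modules*, CUP 2006, Thm. 14.5.2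
  and its proof (pp. 276–277). [HunekeSwanson2006]
* The Stacks Project, Tag 01J7 (points of `Spec 𝒪_{X,x}`), Tag 0BA8. [StacksProject]
* R. Hartshorne, *Algebraic Geometry* (1977), proof of Cor. III.11.4 (`K(X) = Frac T`). [Hartshorne1977]
-/

noncomputable section

open CategoryTheory CategoryTheory.Limits AlgebraicGeometry TopologicalSpace Topology IsLocalRing
open Literature.AlgebraicGeometry.Morphisms

namespace Literature.AlgebraicGeometry.Resolution

universe u

/-! ## The key lemma in ring-homomorphism form -/

/-- **`𝔪_R S` is principal, ring-homomorphism form** of the key lemma of quadratic transforms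
(`exists_map_maximalIdeal_eq_span_singleton_of_ne`, Huneke–Swanson 14.5.2 "the crucial point"): let
`f : R → S` be an injective local homomorphism of two-dimensional regular local rings which is NOT
surjective, and let `K ⊇ S` be a fraction field of `S` in which every element is a quotient of elements
coming from `R` (so `K = Frac R = Frac S`: `S` is a birational local extension dominating `R`). Then the
extended ideal `𝔪_R S` is principal, generated by a non-zero element of `S`.
[cite: HunekeSwanson2006, Thm. 14.5.2 (proof, "the crucial point")] -/
theorem exists_map_maximalIdeal_eq_span_singleton_of_not_surjective
    {R S K : Type u} [CommRing R] [CommRing S] [Field K]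
    [IsRegularLocalRing R] [IsRegularLocalRing S]
    (hRdim : ringKrullDim R = 2) (hSdim : ringKrullDim S = 2)
    [Algebra S K] [IsFractionRing S K] (f : R →+* S) (hf : Function.Injective f) [IsLocalHom f]
    (hfrac : ∀ z : K, ∃ a b : R, f b ≠ 0 ∧ z = algebraMap S K (f a) / algebraMap S K (f b))
    (hns : ¬ Function.Surjective f) :
    ∃ g : S, g ≠ 0 ∧ (maximalIdeal R).map f = Ideal.span {g} := by
  classical
  haveI := isDomain_of_isRegularLocalRing S
  set φ : S →+* K := algebraMap S K with hφdef
  have hφ : Function.Injective φ := IsFractionRing.injective S K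
  -- `R' = R ⊆ S' = S` inside `K`
  set S' : Subring K := φ.range with hS'def
  set R' : Subring K := (φ.comp f).range with hR'def
  have hle : R' ≤ S' := by
    rintro _ ⟨r, rfl⟩
    exact ⟨f r, rfl⟩
  let eS : S ≃+* S' := RingEquiv.ofBijective φ.rangeRestrict
    ⟨fun a b h => hφ (congrArg Subtype.val h), φ.rangeRestrict_surjective⟩
  let eR : R ≃+* R' := RingEquiv.ofBijective (φ.comp f).rangeRestrict
    ⟨fun a b h => (hφ.comp hf) (congrArg Subtype.val h), (φ.comp f).rangeRestrict_surjective⟩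
  -- hypotheses of the key lemma
  haveI hR' : IsRegularLocalRing R' := IsRegularLocalRing.of_ringEquiv eR
  haveI hS' : IsRegularLocalRing S' := IsRegularLocalRing.of_ringEquiv eS
  have hR'dim : ringKrullDim R' = 2 := (ringKrullDim_eq_of_ringEquiv eR).symm.trans hRdim
  have hS'dim : ringKrullDim S' = 2 := (ringKrullDim_eq_of_ringEquiv eS).symm.trans hSdim
  have hRK : IsLocalRingOf R' := by
    refine ⟨inferInstance, fun z => ?_⟩
    obtain ⟨a, b, hb, rfl⟩ := hfrac z
    refine ⟨φ (f a), ⟨a, rfl⟩, φ (f b), ⟨b, rfl⟩, fun h => hb (hφ ?_), rfl⟩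
    rw [h, map_zero]
  have hdom : SubringDominates R' S' := by
    refine ⟨hle, ?_⟩
    rintro _ ⟨r, rfl⟩ hinv
    change (φ (f r))⁻¹ ∈ R'
    by_cases hr0 : φ (f r) = 0
    · rw [hr0, inv_zero]
      exact R'.zero_mem
    obtain ⟨s, hs⟩ := hinv
    change φ s = (φ (f r))⁻¹ at hs
    have hunit : IsUnit (f r) := by
      refine IsUnit.of_mul_eq_one s (hφ ?_)
      rw [map_mul, map_one, hs, mul_inv_cancel₀ hr0]
    obtain ⟨ri, hri⟩ := (isUnit_of_map_unit f r hunit).exists_right_inv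
    refine ⟨ri, ?_⟩
    change φ (f ri) = (φ (f r))⁻¹
    symm
    rw [inv_eq_iff_eq_inv]
    symm
    apply inv_eq_of_mul_eq_one_left
    rw [← map_mul, ← map_mul, hri, map_one, map_one]
  have hne : R' ≠ S' := by
    intro h
    apply hns
    intro s
    have hs : φ s ∈ R' := by
      rw [h]
      exact ⟨s, rfl⟩
    obtain ⟨r, hr⟩ := hs
    exact ⟨r, hφ hr⟩
  obtain ⟨x0, hx0, hmap⟩ :=
    exists_map_maximalIdeal_eq_span_singleton_of_ne hR' hR'dim hRK hS' hS'dim hdom hne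
  refine ⟨eS.symm (Subring.inclusion hdom.1 x0), ?_, ?_⟩
  · have h1 : Subring.inclusion hdom.1 x0 ≠ 0 := fun h =>
      hx0 (Subring.inclusion_injective hdom.1 (h.trans (map_zero _).symm))
    exact fun h => h1 ((map_eq_zero_iff _ eS.symm.injective).mp h)
  · have h1 : maximalIdeal R' = (maximalIdeal R).map eR.toRingHom :=
      (map_ringEquiv_maximalIdeal eR).symm
    have h2 : ((maximalIdeal R).map f).map eS.toRingHom =
        Ideal.span {Subring.inclusion hdom.1 x0} := by
      rw [← hmap, h1, Ideal.map_map, Ideal.map_map]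
      rfl
    apply_fun Ideal.map eS.symm.toRingHom at h2
    rw [Ideal.map_map, Ideal.map_span, Set.image_singleton] at h2
    have h3 : eS.symm.toRingHom.comp eS.toRingHom = RingHom.id S := by
      ext s
      simp
    rw [h3, Ideal.map_id] at h2
    exact h2

/-! ## The structure map `T → Γ(X, 𝒪_X) → 𝒪_{X,x}` of a scheme over a local ring -/

section LocalBase

variable {T : Type u} [CommRing T] {X : Scheme.{u}} (π : X ⟶ Spec (.of T))

/-- The structure map `T → 𝒪_{X,x}` (`algebraMapΓ` followed by the germ) is the stalk map of `π`
after `T → 𝒪_{Spec T, π x}`: `germ_x ∘ π^* = π^*_x ∘ germ_{π x}`.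
[cite: Hartshorne1977, Ch. II, Prop. 2.3 (b)–(c) (p. 73: the stalk maps of `Spec` of a ring map)] -/
theorem germ_algebraMapΓ_eq_stalkMap_germ (x : X) (t : T) :
    (X.presheaf.germ ⊤ x trivial).hom (algebraMapΓ π t) =
      (π.stalkMap x).hom (((Spec (.of T)).presheaf.germ ⊤ (π.base x) trivial).hom
        ((Scheme.ΓSpecIso (.of T)).inv.hom t)) := by
  rw [Scheme.Hom.germ_stalkMap_apply]
  rfl

/-- On `Spec T`, the germ of the global function `t` at `y` is the image of `t` under the
localisation map `T → T_y = 𝒪_{Spec T, y}`. [cite: Hartshorne1977, Ch. II, Prop. 2.2 (a) (p. 71: `𝒪_𝔭 ≅ A_𝔭`)] -/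
theorem germ_top_ΓSpecIso_inv_eq_algebraMap (y : Spec (.of T)) (t : T) :
    letI : Algebra T ((Spec (.of T)).presheaf.stalk y) := StructureSheaf.stalkAlgebra T y
    ((Spec (.of T)).presheaf.germ ⊤ y trivial).hom ((Scheme.ΓSpecIso (.of T)).inv.hom t) =
      algebraMap T ((Spec (.of T)).presheaf.stalk y) t := by
  letI : Algebra T ((Spec (.of T)).presheaf.stalk y) := StructureSheaf.stalkAlgebra T y
  have hgerm : ((Spec (.of T)).presheaf.germ ⊤ y trivial).hom.comp (Scheme.ΓSpecIso (.of T)).inv.hom =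
      algebraMap T ((Spec (.of T)).presheaf.stalk y) := by
    rw [← CommRingCat.hom_comp, Scheme.ΓSpecIso_inv]
    exact congrArg CommRingCat.Hom.hom (StructureSheaf.algebraMap_germ (R := T) ⊤ y trivial)
  exact RingHom.congr_fun hgerm t

variable [IsLocalRing T]

/-- **`T → 𝒪_{X,x}` is a local homomorphism at points over the closed point** (a morphism of
locally ringed spaces induces local homomorphisms `𝒪_{Spec T, π x} → 𝒪_{X,x}`, and
`T → T_𝔪 = 𝒪_{Spec T, 𝔪}` is local). [cite: Hartshorne1977, Ch. II, §2 (p. 72: morphisms of locally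
ringed spaces) with Prop. 2.2 (a)] -/
theorem isLocalHom_germ_algebraMapΓ {x : X} (hx : π.base x = closedPoint T) :
    IsLocalHom ((X.presheaf.germ ⊤ x trivial).hom.comp (algebraMapΓ π)) := by
  letI : Algebra T ((Spec (.of T)).presheaf.stalk (π.base x)) :=
    StructureSheaf.stalkAlgebra T (π.base x)
  haveI : IsLocalization.AtPrime ((Spec (.of T)).presheaf.stalk (π.base x)) (π.base x).asIdeal :=
    StructureSheaf.IsLocalization.to_stalk T (π.base x)
  refine ⟨fun t ht => ?_⟩
  rw [RingHom.comp_apply, germ_algebraMapΓ_eq_stalkMap_germ, germ_top_ΓSpecIso_inv_eq_algebraMap] at ht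
  have h1 : IsUnit (algebraMap T ((Spec (.of T)).presheaf.stalk (π.base x)) t) :=
    isUnit_of_map_unit _ _ ht
  rw [IsLocalization.AtPrime.isUnit_to_map_iff _ (π.base x).asIdeal] at h1
  have h2 : t ∉ maximalIdeal T := by
    have : (π.base x).asIdeal = maximalIdeal T := by rw [hx]; rfl
    rw [← this]
    exact h1
  by_contra h
  exact h2 ((IsLocalRing.mem_maximalIdeal t).mpr h)

/-- **`(𝔪_T·𝒪_X)_x = 𝔪_T 𝒪_{X,x}`**: for the ideal sheaf `I` of the closed point of `Spec T`
(`I(⊤) = 𝔪_T`) and any `π : X → Spec T`, the stalk at `x` of the pulled-back ideal sheaf `I·𝒪_X` is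
the extension of `𝔪_T` along `T → 𝒪_{X,x}` (the inverse image ideal sheaf `π⁻¹𝒥·𝒪_X`, whose
stalks are the extended ideals). [cite: Hartshorne1977, Ch. II, §7 (p. 163: the inverse image ideal
sheaf `f⁻¹𝒥·𝒪_X`)] -/
theorem stalkIdeal_comap_eq_map_maximalIdeal (I : (Spec (.of T)).IdealSheafData)
    (hI : I.ideal ⟨⊤, isAffineOpen_top _⟩ =
      Ideal.map (Scheme.ΓSpecIso (.of T)).inv.hom (maximalIdeal T)) (x : X) :
    stalkIdeal (I.comap π) x =
      (maximalIdeal T).map ((X.presheaf.germ ⊤ x trivial).hom.comp (algebraMapΓ π)) := by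
  rw [stalkIdeal_comap_eq_map π I x,
    stalkIdeal_eq_map_germ I ⟨⊤, isAffineOpen_top _⟩ (trivial : π.base x ∈ (⊤ : (Spec (.of T)).Opens)),
    hI, Ideal.map_map, Ideal.map_map]
  congr 1
  ext t
  exact (germ_algebraMapΓ_eq_stalkMap_germ π x t).symm

/-- The support of `I·𝒪_X`, `I` the ideal sheaf of the closed point, lies over the closed point
(`Supp(I·𝒪_X) = π⁻¹ Supp(I) = π⁻¹(𝔪)`). [cite: GortzWedhorn2020, Def. 13.90 (p. 413: the inverse
image `f⁻¹(Z)` of the centre)] -/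
theorem base_eq_closedPoint_of_mem_support_comap (I : (Spec (.of T)).IdealSheafData)
    (hI : I.ideal ⟨⊤, isAffineOpen_top _⟩ =
      Ideal.map (Scheme.ΓSpecIso (.of T)).inv.hom (maximalIdeal T)) {x : X}
    (hx : x ∈ (I.comap π).support) : π.base x = closedPoint T := by
  letI : Algebra T ((Spec (.of T)).presheaf.stalk (π.base x)) :=
    StructureSheaf.stalkAlgebra T (π.base x)
  haveI : IsLocalization.AtPrime ((Spec (.of T)).presheaf.stalk (π.base x)) (π.base x).asIdeal :=
    StructureSheaf.IsLocalization.to_stalk T (π.base x)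
  have hx' : π.base x ∈ I.support := by
    rw [Scheme.IdealSheafData.support_comap] at hx
    exact hx
  have hle : stalkIdeal I (π.base x) ≤ maximalIdeal _ := (mem_support_iff_stalkIdeal_le _ _).mp hx'
  rw [stalkIdeal_eq_map_germ I ⟨⊤, isAffineOpen_top _⟩
      (trivial : π.base x ∈ (⊤ : (Spec (.of T)).Opens)), hI, Ideal.map_map,
    Ideal.map_le_iff_le_comap] at hle
  have hmx : maximalIdeal T ≤ (π.base x).asIdeal := fun t ht => by
    have h1 := hle ht
    rw [Ideal.mem_comap, RingHom.comp_apply] at h1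
    change ((Spec (.of T)).presheaf.germ ⊤ (π.base x) trivial).hom
      ((Scheme.ΓSpecIso (.of T)).inv.hom t) ∈ _ at h1
    rw [germ_top_ΓSpecIso_inv_eq_algebraMap] at h1
    exact (IsLocalization.AtPrime.to_map_mem_maximal_iff
      ((Spec (.of T)).presheaf.stalk (π.base x)) (π.base x).asIdeal t).mp h1
  exact PrimeSpectrum.ext (((maximalIdeal.isMaximal T).eq_of_le (π.base x).2.ne_top hmx).symm)

end LocalBase

/-! ## `T → 𝒪_{X,x}` for a resolution: injective, birational, not surjective at closed points -/

section Resolution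

variable {T : Type u} [CommRing T] [IsDomain T] {X : Scheme.{u}} (π : X ⟶ Spec (.of T))

omit [IsDomain T] in
/-- Along `𝒪_{X,x} ⊆ K(X)` the structure map `T → 𝒪_{X,x}` becomes `T → K(X)`
(`baseToFunctionField`). [cite: Hartshorne1977, proof of Cor. III.11.4 (p. 280)] -/
theorem algebraMap_germ_algebraMapΓ [IsIntegral X] (x : X) (t : T) :
    algebraMap (X.presheaf.stalk x) X.functionField
      (((X.presheaf.germ ⊤ x trivial).hom.comp (algebraMapΓ π)) t) = baseToFunctionField π t := by
  haveI : Nonempty (⊤ : X.Opens) := ⟨⟨x, trivial⟩⟩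
  rw [RingHom.comp_apply, Scheme.algebraMap_germ_eq_germToFunctionField]
  rfl

/-- **`T → 𝒪_{X,x}` is injective** for `π : X → Spec T` birational (`X` integral, `T` a domain):
`T → K(X) = Frac T` is. [cite: Hartshorne1977, proof of Cor. III.11.4 (p. 280)] -/
theorem germ_algebraMapΓ_injective [IsIntegral X] (hπ : IsBirational π) (x : X) :
    Function.Injective ((X.presheaf.germ ⊤ x trivial).hom.comp (algebraMapΓ π)) := by
  haveI : IsDominant π := hπ.isDominant
  letI := (baseToFunctionField π).toAlgebra
  haveI : IsFractionRing T X.functionField :=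
    isFractionRing_baseToFunctionField π hπ.isIso_stalkMap_genericPoint
  intro a b hab
  have h := congrArg (algebraMap (X.presheaf.stalk x) X.functionField) hab
  rw [algebraMap_germ_algebraMapΓ, algebraMap_germ_algebraMapΓ] at h
  exact IsFractionRing.injective T X.functionField h

/-- **`K(X)` is the common fraction field**: for `π : X → Spec T` birational, every rational function
on `X` is a quotient of (the images in `𝒪_{X,x}` of) two elements of `T`.
[cite: Hartshorne1977, proof of Cor. III.11.4 (p. 280: `K(X) = K(Y)` for `f` birational)] -/
theorem exists_eq_div_germ_algebraMapΓ [IsIntegral X] (hπ : IsBirational π) (x : X)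
    (z : X.functionField) :
    ∃ a b : T, ((X.presheaf.germ ⊤ x trivial).hom.comp (algebraMapΓ π)) b ≠ 0 ∧
      z = algebraMap (X.presheaf.stalk x) X.functionField
            (((X.presheaf.germ ⊤ x trivial).hom.comp (algebraMapΓ π)) a) /
          algebraMap (X.presheaf.stalk x) X.functionField
            (((X.presheaf.germ ⊤ x trivial).hom.comp (algebraMapΓ π)) b) := by
  haveI : IsDominant π := hπ.isDominant
  letI := (baseToFunctionField π).toAlgebra
  haveI : IsFractionRing T X.functionField :=
    isFractionRing_baseToFunctionField π hπ.isIso_stalkMap_genericPoint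
  obtain ⟨a, b, hb, hab⟩ := IsFractionRing.div_surjective (A := T) z
  refine ⟨a, b, fun h => nonZeroDivisors.ne_zero hb (germ_algebraMapΓ_injective π hπ x ?_), ?_⟩
  · rw [h, map_zero]
  · rw [algebraMap_germ_algebraMapΓ, algebraMap_germ_algebraMapΓ, ← hab]
    rfl

variable [IsLocalRing T]

omit [IsDomain T] in
/-- **`T → 𝒪_{X,x}` is not surjective at a point with a proper generisation in the closed fibre.**
If `η ⤳ x`, `η ≠ x`, and both lie over the closed point of `Spec T`, then `T → 𝒪_{X,x}` is not onto:
otherwise `𝔪_T 𝒪_{X,x} = 𝔪_x` would lie in the non-maximal prime `𝔭_η` of `𝒪_{X,x}` (the elements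
of `𝔪_T` are non-units in `𝒪_{X,η}`). [cite: StacksProject, Tag 01J7] -/
theorem germ_algebraMapΓ_not_surjective {x η : X} (hηx : η ⤳ x) (hne : η ≠ x)
    (hη : π.base η = closedPoint T) :
    ¬ Function.Surjective ((X.presheaf.germ ⊤ x trivial).hom.comp (algebraMapΓ π)) := by
  intro hsurj
  set ψ := (X.presheaf.germ ⊤ x trivial).hom.comp (algebraMapΓ π) with hψ
  haveI hηloc := isLocalHom_germ_algebraMapΓ π hη
  -- the prime of `η` in `𝒪_{X,x}` is not maximal
  have hP : primeOfSpecializes hηx ≠ maximalIdeal (X.presheaf.stalk x) := by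
    intro h
    apply hne
    refine Literature.AlgebraicGeometry.Motives.eq_of_comap_maximalIdeal_eq hηx (specializes_refl x)
      (h.trans ?_)
    rw [TopCat.Presheaf.stalkSpecializes_refl, CommRingCat.hom_id, Ideal.comap_id]
  -- but it contains `𝔪_T 𝒪_{X,x} = 𝔪_x`
  have hle : (maximalIdeal T).map ψ ≤ primeOfSpecializes hηx := by
    rw [Ideal.map_le_iff_le_comap]
    intro t ht
    rw [Ideal.mem_comap, Ideal.mem_comap, hψ, RingHom.comp_apply, ← CommRingCat.comp_apply,
      TopCat.Presheaf.germ_stalkSpecializes]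
    have h1 : ¬ IsUnit (((X.presheaf.germ ⊤ η trivial).hom.comp (algebraMapΓ π)) t) := fun h =>
      ((IsLocalRing.mem_maximalIdeal t).mp ht) (isUnit_of_map_unit _ _ h)
    exact (IsLocalRing.mem_maximalIdeal _).mpr h1
  rw [IsLocalRing.map_maximalIdeal_of_surjective ψ hsurj] at hle
  exact hP ((maximalIdeal.isMaximal _).eq_of_le Ideal.IsPrime.ne_top' hle).symm

end Resolution

end Literature.AlgebraicGeometry.Resolution

end
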